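import Mathlib.Tactic
import Literature.Computability.QuantumComplexity.BQPMajorityAmplification
import Literature.Computability.Cryptography.ClassBQP
import Literature.Computability.Complexity.Promise
import HarnessLib

/-!
# SoloInformedThresholdAmplification — `PromiseBQP(a, b) = PromiseBQP` for constants `0 ≤ b < a`

Solo seat `solo-QuantumAdvantage-informed` (ideation tier, summit-directed). The tree's promise classes
carry only the symmetric thresholds `(1 - ε, ε)` (`PromiseBQPWith`, `PromiseBQPWith_eq_PromiseBQP`); the
pseudo-deterministic lift programme of `SoloInformedPseudoDeterministicLift` (`abs_gridCount_div_sub_le`,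
`thresholdSet_separates`) needs the SHIFTED thresholds: for a uniform oracle-free Clifford+`T` family `F` and
constants `b < a`, the promise problem `⟨{x | a ≤ p_F(x)}, {x | p_F(x) ≤ b}⟩` is in `PromiseBQP` (Watrous 2009,
§III.1 / Prop. 3: `BQP(a, b) = BQP` whenever `a - b ≥ 1/poly`; here constants). This file proves it in the
tree's circuit model by re-running the majority-vote construction of `BQPMajorityAmplification.lean` with a
general THRESHOLD read-out:

* `sum_deviation_ge_mul_le` — the two-sided weighted Chebyshev bound: under probability weights `w` on a
  finite outcome type with good weight `μ`, the product weight of the sequences `ω : Fin m → α` with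
  `m η ≤ |#{i | good (ω i)} - m μ|` is at most `1/(4 m η²)` (the proof of
  `Literature.Computability.Complexity.sum_majority_fail_mul_le`, with the mean computed exactly);
* the `FP` read-out "at least `c` of the `K` answer positions read accept" is the tree's
  `PostBQPAmp.thrF (PostBQPAmp.posPoly P) c P.K`; `thrReadout_boolPair` is its semantics;
* `kernelProb_thrReadout_ge` — the `K`-copy family `PostBQPAmp.family P` followed by that read-out answers
  `β` with probability `≥ 1 - 1/(4Kη²)` as soon as every answer pattern on which the read-out is not `β`
  deviates by `≥ K η` from `K · p_F(x)`;
* `exists_threshold_amplified` — for `K ≥ 1`, `t ≥ 0`, `η > 0`: a uniform oracle-free family accepting with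
  probability `≥ 1 - 1/(4Kη²)` where `p_F ≥ t + η` and `≤ 1/(4Kη²)` where `p_F ≤ t - η`
  (read-out threshold `⌊K t⌋ + 1`, classical wrap `CWrap.family`);
* `mem_PromiseBQP_of_thresholds` — **`PromiseBQP(a, b) ⊆ PromiseBQP`** for constants `0 ≤ b < a`;
  `thresholdPromise_mem_PromiseBQP` — the threshold-set instance used by the lift programme.

[cite: Watrous2009, §III.1 (BQP = BQP(a,b) for constants) and Prop. 3] [cite: BennettBernsteinBrassardVazirani1997, Thm. 4.13 (proof)]
[cite: Kranakis1986, Thm. 3.5]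
-/

noncomputable section

namespace Summit.QuantumAdvantage.QuantumAdvantage.Theorems

section Chebyshev

open _root_.MeasureTheory _root_.ProbabilityTheory Finset

/-- **Two-sided weak law for a weighted count (Chebyshev form).** Let `w` be probability weights on a
finite outcome type `α` (`w ≥ 0`, `∑ w = 1`) and `μ = ∑_{good} w` the good weight. Then the product weight
of the sequences `ω : Fin m → α` of `m ≥ 1` trials whose number of good trials deviates from `m μ` by at
least `m η` (`η > 0`), times `4 m η²`, is at most `1` (the count has mean `m μ` and variance `≤ m/4`).
[cite: Kranakis1986, Thm. 3.5] [cite: BennettBernsteinBrassardVazirani1997, Thm. 4.13 (proof)] -/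
theorem sum_deviation_ge_mul_le {α : Type*} [Fintype α] (w : α → ℝ) (hw : ∀ a, 0 ≤ w a)
    (hw1 : ∑ a, w a = 1) (good : α → Prop) [DecidablePred good] {m : ℕ} (hm : 0 < m) {η : ℝ}
    (hη : 0 < η) :
    (∑ ω ∈ univ.filter (fun ω : Fin m → α =>
        (m : ℝ) * η ≤ |((univ.filter fun i => good (ω i)).card : ℝ) - m * (∑ a ∈ univ.filter good, w a)|),
        ∏ i, w (ω i)) * (4 * m * η ^ 2) ≤ 1 := by
  classical
  letI : MeasurableSpace α := ⊤
  haveI : MeasurableSingletonClass α := ⟨fun _ => MeasurableSpace.measurableSet_top⟩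
  -- one trial: the measure with the weights `w`, and the indicator `X` of a good outcome
  have hsum : ∑ a, ENNReal.ofReal (w a) = 1 := by
    rw [← ENNReal.ofReal_sum_of_nonneg (fun a _ => hw a), hw1, ENNReal.ofReal_one]
  set p : PMF α := PMF.ofFintype (fun a => ENNReal.ofReal (w a)) hsum with hp
  set μ : Measure α := p.toMeasure with hμ
  have hμa : ∀ a : α, μ {a} = ENNReal.ofReal (w a) := fun a => by
    rw [hμ, p.toMeasure_apply_singleton a (measurableSet_singleton a), hp, PMF.ofFintype_apply]
  set X : α → ℝ := fun a => if good a then 1 else 0 with hX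
  have hXmeas : Measurable X := measurable_of_finite X
  have hXbdd : ∀ᵐ a ∂μ, X a ∈ Set.Icc (0 : ℝ) 1 :=
    ae_of_all _ fun a => by simp only [hX]; split_ifs <;> simp
  have hXLp : MemLp X 2 μ := memLp_of_bounded hXbdd hXmeas.aestronglyMeasurable 2
  -- its mean is the good weight
  have hmean : μ[X] = ∑ a ∈ univ.filter good, w a := by
    rw [integral_fintype (MemLp.integrable (by norm_num) hXLp)]
    have hsing : ∀ a : α, μ.real {a} = w a := fun a => by
      rw [measureReal_def, hμa, ENNReal.toReal_ofReal (hw a)]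
    simp only [hsing, smul_eq_mul]
    rw [Finset.sum_filter]
    exact Finset.sum_congr rfl fun a _ => by simp only [hX]; split_ifs <;> simp
  -- its variance is at most `1/4`
  have hvar : Var[X; μ] ≤ 1 / 4 := by
    have h := variance_le_sub_mul_sub hXbdd hXmeas.aemeasurable
    nlinarith [h, sq_nonneg (μ[X] - 1 / 2)]
  -- `m` independent trials: the product measure, and the number `S` of good trials
  set P : Measure (Fin m → α) := Measure.pi fun _ : Fin m => μ with hP
  set S : (Fin m → α) → ℝ := ∑ i : Fin m, fun ω => X (ω i) with hS
  have hSLp : MemLp S 2 P := by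
    refine memLp_finsetSum' _ fun i _ => ?_
    exact hXLp.comp_measurePreserving (measurePreserving_eval (fun _ : Fin m => μ) i)
  have hSvar : Var[S; P] ≤ m / 4 := by
    rw [hS, hP, variance_sum_pi fun _ => hXLp]
    calc ∑ _i : Fin m, Var[X; μ] ≤ ∑ _i : Fin m, (1 / 4 : ℝ) := Finset.sum_le_sum fun i _ => hvar
      _ = m / 4 := by
          simp only [Finset.sum_const, Finset.card_univ, Fintype.card_fin]; ring
  have hSmean : P[S] = (m : ℝ) * ∑ a ∈ univ.filter good, w a := by
    have hint : ∀ i : Fin m, ∫ ω, X (ω i) ∂P = μ[X] := fun i => by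
      have hmp := measurePreserving_eval (fun _ : Fin m => μ) i
      rw [← hmp.map_eq, integral_map (measurable_pi_apply i).aemeasurable
        hXmeas.aestronglyMeasurable]
    have : P[S] = ∑ i : Fin m, ∫ ω, X (ω i) ∂P := by
      rw [hS, ← integral_finsetSum _ fun i _ => ?_]
      · simp only [Finset.sum_apply]
      · exact MemLp.integrable (by norm_num)
          (hXLp.comp_measurePreserving (measurePreserving_eval (fun _ : Fin m => μ) i))
    rw [this]
    simp only [hint, hmean, Finset.sum_const, Finset.card_univ, Fintype.card_fin, nsmul_eq_mul]
  -- the deviation event is the Chebyshev tail `{m η ≤ |S - E S|}`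
  set B : Finset (Fin m → α) := univ.filter fun ω : Fin m → α =>
    (m : ℝ) * η ≤ |((univ.filter fun i => good (ω i)).card : ℝ) - m * (∑ a ∈ univ.filter good, w a)|
    with hB
  have hSval : ∀ ω, S ω = ((univ.filter fun i => good (ω i)).card : ℝ) := fun ω => by
    rw [hS, Finset.natCast_card_filter, Finset.sum_apply]
  have hsub : (B : Set (Fin m → α)) ⊆ {ω | (m : ℝ) * η ≤ |S ω - P[S]|} := by
    intro ω hω
    rw [Finset.mem_coe, hB, Finset.mem_filter] at hω
    rw [Set.mem_setOf_eq, hSval ω, hSmean]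
    exact hω.2
  have hcheb := meas_ge_le_variance_div_sq hSLp (c := (m : ℝ) * η) (by positivity)
  have hPB : P B ≤ ENNReal.ofReal (1 / (4 * m * η ^ 2)) := by
    refine ((measure_mono hsub).trans hcheb).trans (ENNReal.ofReal_le_ofReal ?_)
    rw [div_le_div_iff₀ (by positivity) (by positivity)]
    have hm' : (1 : ℝ) ≤ m := by exact_mod_cast hm
    nlinarith [hSvar, sq_nonneg η, mul_pos (show (0:ℝ) < m by positivity) (sq_pos_of_pos hη)]
  -- read the product measure of `B` as the product weight
  have hPB' : P B = ENNReal.ofReal (∑ ω ∈ B, ∏ i, w (ω i)) := by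
    rw [← sum_measure_singleton, ENNReal.ofReal_sum_of_nonneg
      (fun ω _ => Finset.prod_nonneg fun i _ => hw (ω i))]
    refine Finset.sum_congr rfl fun ω _ => ?_
    rw [hP, Measure.pi_singleton, ENNReal.ofReal_prod_of_nonneg (fun i _ => hw (ω i))]
    exact Finset.prod_congr rfl fun i _ => hμa (ω i)
  rw [hPB'] at hPB
  have hnn : 0 ≤ ∑ ω ∈ B, ∏ i, w (ω i) :=
    Finset.sum_nonneg fun ω _ => Finset.prod_nonneg fun i _ => hw (ω i)
  have hreal : ∑ ω ∈ B, ∏ i, w (ω i) ≤ 1 / (4 * m * η ^ 2) :=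
    (ENNReal.ofReal_le_ofReal_iff (by positivity)).1 hPB
  rw [le_div_iff₀ (by positivity)] at hreal
  exact hreal

/-- Arithmetic of the yes-side: a count at most `⌊K t⌋` deviates by `≥ K η` below `K p` when
`p ≥ t + η` (`t ≥ 0`). [folklore] -/
theorem deviation_of_count_le_floor {K S : ℕ} {p t η : ℝ} (ht : 0 ≤ t) (hη : 0 < η) (hx : t + η ≤ p)
    (hS : S ≤ ⌊(K : ℝ) * t⌋₊) : (K : ℝ) * η ≤ |(S : ℝ) - K * p| := by
  have hS' : (S : ℝ) ≤ K * t :=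
    calc (S : ℝ) ≤ (⌊(K : ℝ) * t⌋₊ : ℝ) := by exact_mod_cast hS
      _ ≤ K * t := Nat.floor_le (by positivity)
  have hKp : (K : ℝ) * (t + η) ≤ K * p := mul_le_mul_of_nonneg_left hx (Nat.cast_nonneg K)
  have hKη : 0 ≤ (K : ℝ) * η := mul_nonneg (Nat.cast_nonneg K) hη.le
  have hmul : (K : ℝ) * (t + η) = K * t + K * η := by ring
  rw [abs_sub_comm, abs_of_nonneg (by linarith)]
  linarith

/-- Arithmetic of the no-side: a count at least `⌊K t⌋ + 1` deviates by `≥ K η` above `K p` when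
`p ≤ t - η`. [folklore] -/
theorem deviation_of_floor_lt_count {K S : ℕ} {p t η : ℝ} (hη : 0 < η) (hx : p ≤ t - η)
    (hS : ⌊(K : ℝ) * t⌋₊ + 1 ≤ S) : (K : ℝ) * η ≤ |(S : ℝ) - K * p| := by
  have hS' : (K : ℝ) * t ≤ (S : ℝ) := by
    have h2 : (K : ℝ) * t < (⌊(K : ℝ) * t⌋₊ : ℝ) + 1 := Nat.lt_floor_add_one _
    have h3 : ((⌊(K : ℝ) * t⌋₊ : ℝ) + 1 : ℝ) ≤ (S : ℝ) := by exact_mod_cast hS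
    linarith
  have hKp : (K : ℝ) * p ≤ K * (t - η) := mul_le_mul_of_nonneg_left hx (Nat.cast_nonneg K)
  have hKη : 0 ≤ (K : ℝ) * η := mul_nonneg (Nat.cast_nonneg K) hη.le
  have hmul : (K : ℝ) * (t - η) = K * t - K * η := by ring
  rw [abs_of_nonneg (by linarith)]
  linarith

end Chebyshev

open _root_.Computability Literature.Computability.Complexity Literature.Computability.Cryptography
  Literature.Computability.QuantumComplexity Finset

/-! ### The threshold read-out of the `K`-copy family -/

/-- **Semantics of the threshold read-out** on a pair whose data covers the answer positions.
[cite: BennettBernsteinBrassardVazirani1997, Thm. 4.13 (proof; step 4)] -/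
theorem thrReadout_boolPair (P : PostBQPAmp.Params) (c : ℕ) (x y : List Bool)
    (h : ∀ j < P.K, PostBQPAmp.blk P x.length j 0 < y.length) :
    PostBQPAmp.thrF (PostBQPAmp.posPoly P) c P.K (boolPair x y) = [decide (c ≤ PostBQPAmp.accCount P x y)] := by
  unfold PostBQPAmp.accCount
  rw [PostBQPAmp.thrF_boolPair (PostBQPAmp.posPoly P) x y _ _
      (fun i hi => by rw [PostBQPAmp.eval_posPoly]; exact h i hi), PostBQPAmp.cntZero,
    PostBPPHash.card_filter_fin P.K (fun j => y.getD (PostBQPAmp.blk P x.length j 0) false = false)]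
  simp only [PostBQPAmp.eval_posPoly]

/-- **The `K`-copy family followed by the threshold read-out answers `β` with probability at least
`1 - 1/(4Kη²)`** provided every answer pattern `s : Fin K → Bool` on which the read-out differs from `β`
has its accept count at distance `≥ K η` from `K · p_F(x)`: the Born weights of the blocks form a product
distribution with one-block accept marginal `p_F(x)`, and the two-sided Chebyshev bound
`sum_deviation_ge_mul_le` applies. [cite: BennettBernsteinBrassardVazirani1997, Thm. 4.13 (proof)] -/
theorem kernelProb_thrReadout_ge (P : PostBQPAmp.Params) (x : List Bool) (c : ℕ) (β : Bool) {η : ℝ}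
    (hη : 0 < η)
    (hdev : ∀ s : Fin P.K → Bool, decide (c ≤ (univ.filter fun j => s j = true).card) ≠ β →
      (P.K : ℝ) * η ≤ |((univ.filter fun j => s j = true).card : ℝ) - P.K * P.F.acceptProbOn 0 x|) :
    1 - 1 / (4 * P.K * η ^ 2) ≤
      (PostBQPAmp.family P).kernelProb 0 x {y | PostBQPAmp.thrF (PostBQPAmp.posPoly P) c P.K (boolPair x y) = [β]} := by
  classical
  rw [PostBQPAmp.kernelProb_family_eq]
  set w : QReg (PostBQPAmp.b P x.length) → ℝ := fun v => ‖PostBQPAmp.blockState P x v‖ ^ 2 with hw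
  set good : QReg (PostBQPAmp.b P x.length) → Prop :=
    fun v => v ⟨0, PostBQPAmp.b_pos P x.length⟩ = true with hgooddef
  set fail : (Fin P.K → QReg (PostBQPAmp.b P x.length)) → Prop := fun y =>
    (P.K : ℝ) * η ≤ |((univ.filter fun j => good (y j)).card : ℝ) - P.K * P.F.acceptProbOn 0 x|
    with hfail
  have hw0 : ∀ v, 0 ≤ w v := fun v => by positivity
  have hw1 : ∑ v, w v = 1 := PostBQPAmp.sum_normSq_blockState x
  have hμ : ∑ v ∈ univ.filter good, w v = P.F.acceptProbOn 0 x :=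
    PostBQPAmp.sum_filter_blockState_wire0 x
  -- the weighted Chebyshev bound for the product weights
  have hcheb := sum_deviation_ge_mul_le w hw0 hw1 good P.hK hη
  rw [hμ] at hcheb
  have hpos : (0 : ℝ) < 4 * P.K * η ^ 2 := by have := P.hK; positivity
  have hfailSum : (∑ y ∈ univ.filter fail, ∏ j, w (y j)) ≤ 1 / (4 * P.K * η ^ 2) := by
    rw [le_div_iff₀ hpos]; exact hcheb
  -- total product weight `1`
  have htot : (∑ y : Fin P.K → QReg (PostBQPAmp.b P x.length), ∏ j, w (y j)) = 1 := by
    have e := Finset.prod_univ_sum (fun _ : Fin P.K => (univ : Finset (QReg (PostBQPAmp.b P x.length))))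
      (fun _ v => w v)
    simp only [Fintype.piFinset_univ] at e
    rw [← e, hw1, Finset.prod_const_one]
  -- termwise comparison after the pull-back along stage 2
  have hterm : ∀ z : QReg (x.length + PostBQPAmp.anc P x.length),
      ‖prodState (PostBQPAmp.blockEmb P x.length) (fun _ => PostBQPAmp.blockState P x)
          (PostBQPAmp.W1 P x) z‖ ^ 2 *
          (1 - if fail (fun j => z ∘ PostBQPAmp.blockEmb P x.length j) then 1 else 0) ≤
        (if List.ofFn (PostBQPAmp.perm2 P x.length z) ∈ {y | PostBQPAmp.thrF (PostBQPAmp.posPoly P) c P.K (boolPair x y) = [β]} then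
          ‖prodState (PostBQPAmp.blockEmb P x.length) (fun _ => PostBQPAmp.blockState P x)
            (PostBQPAmp.W1 P x) z‖ ^ 2 else 0) := by
    intro z
    by_cases hf : fail (fun j => z ∘ PostBQPAmp.blockEmb P x.length j)
    · rw [if_pos hf, sub_self, mul_zero]
      split_ifs <;> positivity
    · rw [if_neg hf, sub_zero, mul_one, if_pos]
      rw [Set.mem_setOf_eq, thrReadout_boolPair P c x _ (fun j hj => by
        rw [List.length_ofFn]; exact PostBQPAmp.blk_fits hj (PostBQPAmp.b_pos P x.length)),
        PostBQPAmp.accCount_ofFn_perm2]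
      congr 1
      by_contra hne
      apply hf
      have hd := hdev (fun j => z (PostBQPAmp.ansW x.length j)) hne
      simpa only [hfail, hgooddef, Function.comp_apply, PostBQPAmp.blockEmb_zero] using hd
  calc 1 - 1 / (4 * P.K * η ^ 2)
      ≤ 1 - ∑ y ∈ univ.filter fail, ∏ j, w (y j) := by linarith
    _ = ∑ y : Fin P.K → QReg (PostBQPAmp.b P x.length),
          (∏ j, w (y j)) * (1 - if fail y then 1 else 0) := by
        have e : ∀ y : Fin P.K → QReg (PostBQPAmp.b P x.length),
            (∏ j, w (y j)) * (1 - if fail y then 1 else 0) =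
              (∏ j, w (y j)) - (if fail y then ∏ j, w (y j) else 0) := fun y => by
          split_ifs <;> ring
        simp only [e, Finset.sum_sub_distrib, htot, Finset.sum_filter]
    _ = ∑ z : QReg (x.length + PostBQPAmp.anc P x.length),
          ‖prodState (PostBQPAmp.blockEmb P x.length) (fun _ => PostBQPAmp.blockState P x)
              (PostBQPAmp.W1 P x) z‖ ^ 2 *
            (1 - if fail (fun j => z ∘ PostBQPAmp.blockEmb P x.length j) then 1 else 0) :=
        (sum_normSq_prodState_mul PostBQPAmp.blockDisjoint (fun _ => PostBQPAmp.blockState P x)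
          (PostBQPAmp.W1 P x) (fun y => 1 - if fail y then 1 else 0)).symm
    _ ≤ _ := Finset.sum_le_sum fun z _ => hterm z

/-! ### The threshold-amplified family -/

/-- **Threshold amplification of a uniform quantum circuit family**: for every polynomial-time uniform,
oracle-free Clifford+`T` family `F`, every `K ≥ 1`, threshold `t ≥ 0` and margin `η > 0` there is a
polynomial-time uniform, oracle-free family `F'` — `K` parallel copies of `F` followed by the classical
read-out "at least `⌊K t⌋ + 1` copies accept" — which accepts with probability `≥ 1 - 1/(4Kη²)` every
input that `F` accepts with probability `≥ t + η`, and with probability `≤ 1/(4Kη²)` every input that `F`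
accepts with probability `≤ t - η`. [cite: Watrous2009, Prop. 3] [cite: BennettBernsteinBrassardVazirani1997, Thm. 4.13] -/
theorem exists_threshold_amplified {F : QCircuitFamily cliffordT} (hF : F.IsOracleFree) (hU : F.IsUniform)
    {K : ℕ} (hK : 0 < K) {t η : ℝ} (ht : 0 ≤ t) (hη : 0 < η) :
    ∃ F' : QCircuitFamily cliffordT, F'.IsOracleFree ∧ F'.IsUniform ∧ ∀ x : List Bool,
      (t + η ≤ F.acceptProbOn 0 x → 1 - 1 / (4 * K * η ^ 2) ≤ F'.acceptProbOn 0 x) ∧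
      (F.acceptProbOn 0 x ≤ t - η → F'.acceptProbOn 0 x ≤ 1 / (4 * K * η ^ 2)) := by
  obtain ⟨pF, hpF⟩ := QCircuitFamily.IsUniform.isPolySize' hU
  let P₀ : PostBQPAmp.Params := ⟨F, pF, fun n => (hpF n).2, K, hK⟩
  obtain ⟨c, hc⟩ : ∃ c : ℕ, c = ⌊(K : ℝ) * t⌋₊ + 1 := ⟨_, rfl⟩
  have hRfree : (PostBQPAmp.family P₀).IsOracleFree := PostBQPAmp.family_isOracleFree P₀ hF
  have hRU : (PostBQPAmp.family P₀).IsUniform := PostBQPAmp.family_isUniform P₀ hU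
  obtain ⟨P, hPh, hPg, hPF⟩ := CWrap.exists_params (PolyTimeComputable.id _) (PostBQPAmp.thrF_mem_FP (PostBQPAmp.posPoly P₀) c P₀.K) hRU
  -- the deviation hypotheses of the two sides
  have hdevYes : ∀ x : List Bool, t + η ≤ F.acceptProbOn 0 x → ∀ s : Fin K → Bool,
      decide (c ≤ (univ.filter fun j => s j = true).card) ≠ true →
        (K : ℝ) * η ≤ |((univ.filter fun j => s j = true).card : ℝ) - K * F.acceptProbOn 0 x| :=
    fun x hx s hne => deviation_of_count_le_floor ht hη hx (by
      have : ¬ c ≤ (univ.filter fun j => s j = true).card := fun h => hne (decide_eq_true h)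
      omega)
  have hdevNo : ∀ x : List Bool, F.acceptProbOn 0 x ≤ t - η → ∀ s : Fin K → Bool,
      decide (c ≤ (univ.filter fun j => s j = true).card) ≠ false →
        (K : ℝ) * η ≤ |((univ.filter fun j => s j = true).card : ℝ) - K * F.acceptProbOn 0 x| :=
    fun x hx s hne => deviation_of_floor_lt_count hη hx (by
      have : c ≤ (univ.filter fun j => s j = true).card := by
        by_contra h; exact hne (decide_eq_false h)
      omega)
  refine ⟨CWrap.family P, CWrap.family_isOracleFree P (hPF ▸ hRfree), CWrap.family_isUniform P (hPF ▸ hRU),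
    fun x => ⟨fun hx => ?_, fun hx => ?_⟩⟩
  · -- yes-side: the wrapped family writes `true` first with probability `≥ 1 - 1/(4Kη²)`
    have hker := CWrap.kernelProb_family_ge P x (fun _ => {y | PostBQPAmp.thrF (PostBQPAmp.posPoly P₀) c P₀.K (boolPair x y) = [true]})
    rw [hPh, hPg, hPF] at hker
    have hsub : {z | ∃ y ∈ ({y | PostBQPAmp.thrF (PostBQPAmp.posPoly P₀) c P₀.K (boolPair x y) = [true]} : Set (List Bool)),
        PostBQPAmp.thrF (PostBQPAmp.posPoly P₀) c P₀.K (boolPair x y) <+: z} ⊆ {z | [true] <+: z} := by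
      rintro z ⟨y, hy, hz⟩
      rw [Set.mem_setOf_eq] at hy
      rw [hy] at hz
      exact hz
    rw [← kernelProb_prefix_true_eq_acceptProbOn]
    exact ((kernelProb_thrReadout_ge P₀ x c true hη (hdevYes x hx)).trans hker).trans
      ((CWrap.family P).kernelProb_mono 0 x hsub)
  · -- no-side: the wrapped family writes `false` first with probability `≥ 1 - 1/(4Kη²)`
    have hker := CWrap.kernelProb_family_ge P x (fun _ => {y | PostBQPAmp.thrF (PostBQPAmp.posPoly P₀) c P₀.K (boolPair x y) = [false]})
    rw [hPh, hPg, hPF] at hker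
    have hsub : {z | ∃ y ∈ ({y | PostBQPAmp.thrF (PostBQPAmp.posPoly P₀) c P₀.K (boolPair x y) = [false]} : Set (List Bool)),
        PostBQPAmp.thrF (PostBQPAmp.posPoly P₀) c P₀.K (boolPair x y) <+: z} ⊆ {z | [false] <+: z} := by
      rintro z ⟨y, hy, hz⟩
      rw [Set.mem_setOf_eq] at hy
      rw [hy] at hz
      exact hz
    have h1 := ((kernelProb_thrReadout_ge P₀ x c false hη (hdevNo x hx)).trans hker).trans
      ((CWrap.family P).kernelProb_mono 0 x hsub)
    have h2 := kernelProb_add_kernelProb_le_one (CWrap.family P) 0 x disjoint_prefix_true_false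
    rw [kernelProb_prefix_true_eq_acceptProbOn] at h2
    linarith

/-! ### `PromiseBQP(a, b) = PromiseBQP` for constants -/

/-- **`PromiseBQP(a, b) ⊆ PromiseBQP` for constants `0 ≤ b < a`** (Watrous 2009, §III.1/Prop. 3, promise
form, in the tree's uniform Clifford+`T` model): if a uniform oracle-free family accepts every yes-instance
of `Q` with probability `≥ a` and every no-instance with probability `≤ b`, then `Q ∈ PromiseBQP`
(thresholds `(2/3, 1/3)`), by `exists_threshold_amplified` with `t = (a+b)/2`, `η = (a-b)/2`,
`K = ⌈1/η²⌉`. [cite: Watrous2009, §III.1 (BQP = BQP(a,b) for constants) and Prop. 3] -/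
theorem mem_PromiseBQP_of_thresholds {Q : PromiseProblem} {F : QCircuitFamily cliffordT}
    (hF : F.IsOracleFree) (hU : F.IsUniform) {a b : ℝ} (hb : 0 ≤ b) (hab : b < a)
    (hyes : ∀ x ∈ Q.yes, a ≤ F.acceptProbOn 0 x) (hno : ∀ x ∈ Q.no, F.acceptProbOn 0 x ≤ b) :
    Q ∈ PromiseBQP := by
  have hη : 0 < (a - b) / 2 := by linarith
  have ht : 0 ≤ (a + b) / 2 := by linarith
  obtain ⟨K, hK, hKη⟩ : ∃ K : ℕ, 0 < K ∧ 1 / (4 * K * ((a - b) / 2) ^ 2) ≤ 1 / 3 := by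
    have hpos : 0 < ((a - b) / 2) ^ 2 := by positivity
    refine ⟨⌈1 / ((a - b) / 2) ^ 2⌉₊, Nat.ceil_pos.2 (by positivity), ?_⟩
    have h1 : 1 / ((a - b) / 2) ^ 2 ≤ (⌈1 / ((a - b) / 2) ^ 2⌉₊ : ℝ) := Nat.le_ceil _
    have h2 : 1 ≤ (⌈1 / ((a - b) / 2) ^ 2⌉₊ : ℝ) * ((a - b) / 2) ^ 2 := by
      calc (1 : ℝ) = 1 / ((a - b) / 2) ^ 2 * ((a - b) / 2) ^ 2 := (one_div_mul_cancel hpos.ne').symm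
        _ ≤ _ := mul_le_mul_of_nonneg_right h1 hpos.le
    have hKpos : (0 : ℝ) < 4 * (⌈1 / ((a - b) / 2) ^ 2⌉₊ : ℝ) * ((a - b) / 2) ^ 2 := by nlinarith
    rw [div_le_div_iff₀ hKpos (by norm_num)]
    nlinarith
  obtain ⟨F', hF', hU', hF'x⟩ := exists_threshold_amplified hF hU hK ht hη
  refine ⟨F', hF', hU', fun x hx => ?_, fun x hx => ?_⟩
  · have h := (hF'x x).1 (by have := hyes x hx; linarith)
    linarith
  · have h := (hF'x x).2 (by have := hno x hx; linarith)
    linarith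

/-- **The threshold-set promise problem of a uniform family is in `PromiseBQP`**: for constants
`0 ≤ b < a`, `⟨{x | a ≤ p_F(x)}, {x | p_F(x) ≤ b}⟩ ∈ PromiseBQP` — the instance needed by the
pseudo-deterministic lift programme (`abs_gridCount_div_sub_le` with `a = (j+1)/K`, `b = (j-1)/K`).
[cite: Watrous2009, §III.1 (BQP = BQP(a,b) for constants) and Prop. 3] -/
theorem thresholdPromise_mem_PromiseBQP {F : QCircuitFamily cliffordT} (hF : F.IsOracleFree)
    (hU : F.IsUniform) {a b : ℝ} (hb : 0 ≤ b) (hab : b < a) :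
    (⟨{x | a ≤ F.acceptProbOn 0 x}, {x | F.acceptProbOn 0 x ≤ b}⟩ : PromiseProblem) ∈ PromiseBQP :=
  mem_PromiseBQP_of_thresholds hF hU hb hab (fun _ hx => hx) (fun _ hx => hx)

end Summit.QuantumAdvantage.QuantumAdvantage.Theorems

end
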